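import Summits.BirchSwinnertonDyer.BirchSwinnertonDyer.Theorems.Rank1ResidualJetStringentTransport
import Literature.NumberTheory.GaloisRepresentations.PadicAlgebraDegreeOnePlace
import Literature.NumberTheory.EllipticCurves.RootNumberProofs
import Literature.NumberTheory.EllipticCurves.GlobalMinimalModel
import Literature.NumberTheory.EllipticCurves.TamagawaNeZeroProofs
import HarnessLib

/-!
# T1 JET (cell `bsd-jet`), road K: the ROW DATA of the H63 line at the carrier place `v₀ ∣ p`
# (split in `K`) are the `ℚ_p`-data of `W/ℚ` — minimality, the Tamagawa number `c_p`, the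
# component group — transported along `ℚ_p ≃ K_{v₀}`

HONEST FRAMING (programme file §HONESTY, verbatim): «no tranche here proves BSD; ARM L moves the
LITERAL column of an r ≤ 1 census into the kernel-proved-modulo-named-print column.» THEOREMS ONLY
(seat `bsd-jet-pv-2`, session g4; `--supports stmt-BirchSwinnertonDyer-14418`, helper); 0 classes
move; plumbing. WHAT THIS IS. The H63 line (`JET.tamagawaExponent_le_mInfty_of_localFacts'`) is
stated at a place `v₀` of `K` over the carrier prime `p` with `τ • v₀ ≠ v₀`, and takes as ROW DATA:
minimality of `(W⁄K)⁄K_{v₀}` over `𝓞_{v₀}`, `c_{v₀} ≠ 0`, the cyclicity of `E(K_{v₀})/E₀`; its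
conclusion is about `ord_p c_{v₀}(E/K)`. The reading binders K1/K3/K4 and the bridge
(`jetchevDivisibilityCarrierMult_of_prop52_of_coreVertexExistence`, binder `H63`) speak of
`c_p(E/ℚ_p)`. This file identifies the two: at a prime `p` with TWO places `v₀ ≠ τ • v₀` of the
quadratic field `K` above it, `e(v₀|p) = f(v₀|p) = 1` (tree
`ramificationIdx_eq_one_and_inertiaDeg_eq_one_of_ne`), so `ℚ_{(p)} ≃ K_{v₀}` compatibly with the
valuation rings (tree `exists_ringEquiv_adicCompletion_of_ramificationIdx_eq_one_of_inertiaDeg_eq_one`)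
and `ℚ_{(p)} ≃ ℚ_[p]` (Mathlib `padicEquiv`); along these: `(W⁄K)⁄K_{v₀}` is minimal (`W` globally
minimal, `isMinimal_map_iff`), `c_{v₀}((W⁄K)⁄K_{v₀}) = c_p(W⁄ℚ_p)` (`localTamagawaNumber_map_ringEquiv`,
`localTamagawaNumber_padic_eq_holds`), and `E(K_{v₀})/E₀` is cyclic if `E(ℚ_p)/E₀` is (transport of
`E₀`, `isNonsingularReductionPoint_mapPoint_iff`). References: [cite: CasselsFrohlichANT1967, Ch. II
§10 ([L_w : K_v] = ef)] [cite: SilvermanAEC2009, VII.1 Prop. 1.3 (b), VII.6 Ex. 7.6].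
-/

set_option autoImplicit false

noncomputable section

open scoped Classical

open WeierstrassCurve Field IsDedekindDomain NumberField Literature.NumberTheory.EllipticCurves
  Literature.NumberTheory.GaloisRepresentations Literature.NumberTheory.Automorphic

namespace Summit.BirchSwinnertonDyer.Rank1Residual.JET

section Quotient

variable {K₁ K₂ : Type*} [Field K₁] [Field K₂]

/-- Cyclicity of `E/E₀`-type quotients is transported along a surjective point map carrying `E₀`
into `E₀'`. [folklore] -/
theorem isAddCyclic_quotient_of_map {A B : Type*} [AddCommGroup A] [AddCommGroup B] (f : A →+ B)
    (hf : Function.Surjective f) (U : AddSubgroup A) (V : AddSubgroup B) (hUV : U ≤ V.comap f)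
    [h : IsAddCyclic (A ⧸ U)] : IsAddCyclic (B ⧸ V) := by
  refine isAddCyclic_of_surjective (QuotientAddGroup.map U V f hUV) fun y ↦ ?_
  obtain ⟨b, rfl⟩ := QuotientAddGroup.mk_surjective y
  obtain ⟨a, rfl⟩ := hf b
  exact ⟨QuotientAddGroup.mk a, rfl⟩

end Quotient

section Split

variable (W : WeierstrassCurve ℚ) [W.IsElliptic] [W.IsGloballyMinimal]
  (K : Type) [Field K] [NumberField K] (p : ℕ) [Fact p.Prime]

/-- **The carrier row data over `K_{v₀}` are the `ℚ_p`-data.** For `K` imaginary quadratic, `τ ≠ 1`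
in `Aut(K/ℚ)`, a place `v₀ ∋ p` with `τ • v₀ ≠ v₀` (so `p` splits, `e = f = 1`) and `W/ℚ` globally
minimal: `(W⁄K)⁄K_{v₀}` is a minimal equation over `𝓞_{v₀}`, its local Tamagawa number is
`c_p(W⁄ℚ_p)` (hence `≠ 0`), and `E(K_{v₀})/E₀(K_{v₀})` is cyclic whenever `E(ℚ_p)/E₀(ℚ_p)` is
(for the minimal `W⁄ℚ_p` over `ℤ_p`). [cite: CasselsFrohlichANT1967, Ch. II §10]
[cite: SilvermanAEC2009, VII.1 Prop. 1.3 (b), VII.6 Ex. 7.6] -/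
theorem carrierRowData_of_split (hK : IsImaginaryQuadratic K) (τ : K ≃ₐ[ℚ] K)
    (v₀ : HeightOneSpectrum (𝓞 K)) (hv₀ : τ • v₀ ≠ v₀) (hp : ((p : ℕ) : 𝓞 K) ∈ v₀.asIdeal) :
    ∃ (_ : ((W.baseChange K).baseChange (v₀.adicCompletion K)).IsMinimal (v₀.adicCompletionIntegers K))
      (_ : (W.baseChange ℚ_[p]).IsMinimal ℤ_[p]),
      ((W.baseChange K).baseChange (v₀.adicCompletion K)).localTamagawaNumber
          (v₀.adicCompletionIntegers K) = (W.baseChange ℚ_[p]).localTamagawaNumber ℤ_[p] ∧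
      ((W.baseChange K).baseChange (v₀.adicCompletion K)).localTamagawaNumber
          (v₀.adicCompletionIntegers K) ≠ 0 ∧
      (IsAddCyclic ((W.baseChange ℚ_[p]).toAffine.Point ⧸ (W.baseChange ℚ_[p]).goodReductionSubgroup ℤ_[p]) →
        IsAddCyclic (((W.baseChange K).baseChange (v₀.adicCompletion K)).toAffine.Point ⧸
          ((W.baseChange K).baseChange (v₀.adicCompletion K)).goodReductionSubgroup
            (v₀.adicCompletionIntegers K))) := by
  haveI : Algebra.IsQuadraticExtension ℚ K := ⟨hK.1⟩
  -- `e(v₀|p) = f(v₀|p) = 1`: two distinct places over `p`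
  have hp' : ((p : ℕ) : 𝓞 K) ∈ (τ • v₀).asIdeal := by
    have := (HeightOneSpectrum.smul_mem_smul_asIdeal_iff τ v₀ ((p : ℕ) : 𝓞 K)).mpr hp
    have hτp : τ • ((p : ℕ) : 𝓞 K) = (p : 𝓞 K) := by
      rw [← MulSemiringAction.toRingHom_apply, map_natCast]
    rwa [hτp] at this
  obtain ⟨⟨he, hf⟩, -⟩ :=
    LocalField.ramificationIdx_eq_one_and_inertiaDeg_eq_one_of_ne p v₀ (τ • v₀) hv₀.symm hp hp'
  -- the place of `ℚ` below `v₀` is `(p)`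
  let vp : HeightOneSpectrum (𝓞 ℚ) := v₀.under (𝓞 ℚ)
  haveI : v₀.asIdeal.LiesOver vp.asIdeal := ⟨rfl⟩
  have hvp : ((p : ℕ) : 𝓞 ℚ) ∈ vp.asIdeal := LocalField.natCast_mem_under p v₀ hp
  -- `ℚ_{(p)} ≃ K_{v₀}` compatibly with the valuation rings
  obtain ⟨ψ, φ, hc, hφ⟩ :=
    exists_ringEquiv_adicCompletion_of_ramificationIdx_eq_one_of_inertiaDeg_eq_one ℚ K vp v₀ he hf
  have hrange := ringEquiv_mem_range_algebraMap_iff ψ φ hc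
  -- `(W⁄ℚ_{(p)})^φ = (W⁄K)⁄K_{v₀}`
  have hX : (W.baseChange (vp.adicCompletion ℚ)).map (φ : vp.adicCompletion ℚ →+* v₀.adicCompletion K) =
      (W.baseChange K).baseChange (v₀.adicCompletion K) := by
    rw [WeierstrassCurve.baseChange, WeierstrassCurve.baseChange, WeierstrassCurve.baseChange,
      WeierstrassCurve.map_map, WeierstrassCurve.map_map]
    congr 1
    refine RingHom.ext fun x ↦ ?_
    rw [RingHom.comp_apply, RingHom.comp_apply, RingEquiv.coe_toRingHom]
    exact hφ x
  -- minimality over `𝓞_{v₀}` from global minimality over `ℚ`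
  haveI hminQ : (W.baseChange (vp.adicCompletion ℚ)).IsMinimal (vp.adicCompletionIntegers ℚ) :=
    IsGloballyMinimal.isMinimal vp
  haveI hminK : ((W.baseChange K).baseChange (v₀.adicCompletion K)).IsMinimal
      (v₀.adicCompletionIntegers K) := by
    rw [← hX]
    exact (WeierstrassCurve.isMinimal_map_iff φ (fun x ↦ hrange x) _).mpr hminQ
  -- `ℚ_{(p)} ≃ ℚ_[p]` (Mathlib) and minimality of `W⁄ℚ_p`
  obtain hpp : ((Rat.HeightOneSpectrum.primesEquiv vp : Nat.Primes) : ℕ) = p :=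
    LocalField.primesEquiv_eq_of_natCast_mem p vp hvp
  have hTam := WeierstrassCurve.localTamagawaNumber_padic_eq_holds W vp p hpp
  subst hpp
  set φ₀ := (Rat.HeightOneSpectrum.adicCompletion.padicEquiv vp).toRingEquiv with hφ₀
  set ψ₀ := (Rat.HeightOneSpectrum.adicCompletionIntegers.padicIntEquiv vp).toRingEquiv with hψ₀
  have hc₀ : ∀ r : vp.adicCompletionIntegers ℚ,
      φ₀ (algebraMap _ (vp.adicCompletion ℚ) r) = algebraMap _ _ (ψ₀ r) := fun r ↦ rfl
  have hX₀ : (W.baseChange (vp.adicCompletion ℚ)).map (φ₀ : vp.adicCompletion ℚ →+* _) =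
      W.baseChange ℚ_[(Rat.HeightOneSpectrum.primesEquiv vp : ℕ)] := by
    rw [WeierstrassCurve.baseChange, WeierstrassCurve.baseChange, WeierstrassCurve.map_map]
    congr 1
    exact Subsingleton.elim _ _
  haveI hminP : (W.baseChange ℚ_[(Rat.HeightOneSpectrum.primesEquiv vp : ℕ)]).IsMinimal
      ℤ_[(Rat.HeightOneSpectrum.primesEquiv vp : ℕ)] := by
    rw [← hX₀]
    exact (WeierstrassCurve.isMinimal_map_iff φ₀
      (fun x ↦ ringEquiv_mem_range_algebraMap_iff ψ₀ φ₀ hc₀ x) _).mpr hminQ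
  -- the Tamagawa numbers
  haveI : (W.baseChange (vp.adicCompletion ℚ)).IsElliptic := by
    unfold WeierstrassCurve.baseChange; infer_instance
  have hcK : ((W.baseChange K).baseChange (v₀.adicCompletion K)).localTamagawaNumber
      (v₀.adicCompletionIntegers K) =
      (W.baseChange (vp.adicCompletion ℚ)).localTamagawaNumber (vp.adicCompletionIntegers ℚ) := by
    rw [← hX]
    exact WeierstrassCurve.localTamagawaNumber_map_ringEquiv ψ φ hc _
  refine ⟨hminK, hminP, hcK.trans hTam.symm, ?_, fun hΦ ↦ ?_⟩
  · rw [hcK, ← hTam]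
    exact WeierstrassCurve.localTamagawaNumber_padic_ne_zero_holds _ _
  · -- the component group: `E(ℚ_p) → E(ℚ_{(p)}) → E(K_{v₀})` carries `E₀` to `E₀`
    set f₁ : ℚ_[(Rat.HeightOneSpectrum.primesEquiv vp : ℕ)] →+* vp.adicCompletion ℚ :=
      φ₀.symm.toRingHom with hf₁
    have hX₀' : (W.baseChange ℚ_[(Rat.HeightOneSpectrum.primesEquiv vp : ℕ)]).map f₁ =
        W.baseChange (vp.adicCompletion ℚ) := by
      rw [← hX₀, WeierstrassCurve.map_map]
      conv_rhs => rw [← WeierstrassCurve.map_id (W.baseChange (vp.adicCompletion ℚ))]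
      congr 1
      refine RingHom.ext fun x ↦ ?_
      rw [RingHom.comp_apply, RingHom.id_apply, hf₁, RingEquiv.toRingHom_eq_coe,
        RingEquiv.coe_toRingHom, RingEquiv.coe_toRingHom]
      exact φ₀.symm_apply_apply x
    have hc₀' : ∀ r : ℤ_[(Rat.HeightOneSpectrum.primesEquiv vp : ℕ)],
        φ₀.symm (algebraMap _ _ r) = algebraMap _ (vp.adicCompletion ℚ) (ψ₀.symm r) := fun r ↦ by
      apply φ₀.injective
      rw [RingEquiv.apply_symm_apply, hc₀, RingEquiv.apply_symm_apply]
    have hf₁' : (φ₀.symm : ℚ_[(Rat.HeightOneSpectrum.primesEquiv vp : ℕ)] →+* vp.adicCompletion ℚ) = f₁ := by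
      rw [hf₁, RingEquiv.toRingHom_eq_coe]
    let g₁ := mapPoint f₁ hX₀'
    let g₂ := mapPoint (φ : vp.adicCompletion ℚ →+* v₀.adicCompletion K) hX
    haveI := hΦ
    haveI h1 : IsAddCyclic ((W.baseChange (vp.adicCompletion ℚ)).toAffine.Point ⧸
        (W.baseChange (vp.adicCompletion ℚ)).goodReductionSubgroup (vp.adicCompletionIntegers ℚ)) := by
      refine isAddCyclic_quotient_of_map g₁ (mapPoint_surjective _ _ φ₀.symm.surjective)
        ((W.baseChange ℚ_[(Rat.HeightOneSpectrum.primesEquiv vp : ℕ)]).goodReductionSubgroup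
          ℤ_[(Rat.HeightOneSpectrum.primesEquiv vp : ℕ)])
        ((W.baseChange (vp.adicCompletion ℚ)).goodReductionSubgroup (vp.adicCompletionIntegers ℚ))
        fun P hP ↦ ?_
      rw [AddSubgroup.mem_comap, WeierstrassCurve.mem_goodReductionSubgroup_iff_holds]
      rw [WeierstrassCurve.mem_goodReductionSubgroup_iff_holds] at hP
      exact (isNonsingularReductionPoint_mapPoint_iff ψ₀.symm φ₀.symm hc₀' _ (hf₁' ▸ hX₀') P).mpr hP
    refine isAddCyclic_quotient_of_map g₂ (mapPoint_surjective _ _ φ.surjective)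
      ((W.baseChange (vp.adicCompletion ℚ)).goodReductionSubgroup (vp.adicCompletionIntegers ℚ))
      (((W.baseChange K).baseChange (v₀.adicCompletion K)).goodReductionSubgroup
        (v₀.adicCompletionIntegers K)) fun P hP ↦ ?_
    rw [AddSubgroup.mem_comap, WeierstrassCurve.mem_goodReductionSubgroup_iff_holds]
    rw [WeierstrassCurve.mem_goodReductionSubgroup_iff_holds] at hP
    exact (isNonsingularReductionPoint_mapPoint_iff ψ φ hc _ hX P).mpr hP

end Split

end Summit.BirchSwinnertonDyer.Rank1Residual.JET

end
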